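import Summits.QuantumFields.YangMills.Theorems.LangevinControlUVFemtoCurvatureTwoPointCDefsSplit
import Summits.QuantumFields.YangMills.Theorems.LangevinControlUVFemtoCurvatureTwoPointCStubWindowRatio
import Summits.QuantumFields.YangMills.Theorems.LangevinControlUVFemtoCurvatureTwoPointAxisProfileAntitone

/-!
# Route `LangevinControlUV`, crux `FemtoCurvatureTwoPointC` (stmt-QuantumFields-16204), line `Sketch`, reshape v6 —
# bookkeeping bridge: interior profiles + longitudinal monotonicity ⇒ `AFProfilesBigAt r`

Registered stub `stub_coreBridge` of skeleton v6 (`Cruxes/FemtoCurvatureTwoPointC/Lines/Sketch.lean`), landed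
`--supports stmt-QuantumFields-16204`. For every compact `G` and lattice representation `r`.
-/

set_option autoImplicit false

noncomputable section

open Filter Topology MeasureTheory
open Literature.MathematicalPhysics.QuantumFieldTheory

namespace Summit.QuantumFields.YangMills.Theorems.FemtoCurvatureTwoPointC

/-! ## Bookkeeping lemmas: the shrunk window, the bottom scale `s₀ = L / 8`, and the top-range transfer -/

/-- A window height `w` below `u₀` with `w · (|κ₂| + 1) ≤ 1/4` (namely `min u₀ (1/(4(|κ₂|+1)))`). -/
private theorem exists_window (u₀ κ₂ : ℝ) (hu₀ : 0 < u₀) :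
    ∃ w : ℝ, 0 < w ∧ w ≤ u₀ ∧ w * (|κ₂| + 1) ≤ 1 / 4 := by
  have hKpos : 0 < |κ₂| + 1 := by positivity
  refine ⟨min u₀ (1 / (4 * (|κ₂| + 1))), lt_min hu₀ (by positivity), min_le_left _ _, ?_⟩
  have h1 : min u₀ (1 / (4 * (|κ₂| + 1))) ≤ 1 / (4 * (|κ₂| + 1)) := min_le_right _ _
  calc min u₀ (1 / (4 * (|κ₂| + 1))) * (|κ₂| + 1) ≤ 1 / (4 * (|κ₂| + 1)) * (|κ₂| + 1) :=
        mul_le_mul_of_nonneg_right h1 hKpos.le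
    _ = 1 / 4 := by field_simp

/-- The enlarged constant `C' = 2²⁶ · max C 0`: `C ≤ C'` and `8⁸ · 4 · max C 0 ≤ C'`. -/
private theorem exists_constant (C : ℝ) : ∃ C' : ℝ, C ≤ C' ∧ (8 : ℝ) ^ 8 * (4 * max C 0) ≤ C' := by
  have hC0 : 0 ≤ max C 0 := le_max_right _ _
  refine ⟨2 ^ 26 * max C 0, ?_, le_of_eq (by ring)⟩
  calc C ≤ max C 0 := le_max_left _ _
    _ ≤ 2 ^ 26 * max C 0 := le_mul_of_one_le_left hC0 (by norm_num)

/-- The bottom scale `s₀ = L / 8` of a box `L ≥ 8` seen from a top-range separation `s` (`2s ≤ L < 8s`):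
`1 ≤ s₀`, `8 s₀ ≤ L`, `s₀ ≤ s ≤ 8 s₀`, `L ≤ 4 · (8 s₀)`. -/
private theorem exists_bottom_scale {L s : ℕ} (hL : 8 ≤ L) (h2s : 2 * s ≤ L) (h8s : L < 8 * s) :
    ∃ s₀ : ℕ, 1 ≤ s₀ ∧ 8 * s₀ ≤ L ∧ s₀ ≤ s ∧ s ≤ 8 * s₀ ∧ L ≤ 4 * (8 * s₀) :=
  ⟨L / 8, by omega, by omega, by omega, by omega, by omega⟩

/-- Top-range transfer: the clause at the bottom scale `s₀` (`s ≤ 8 s₀`), antitonicity `x ≤ y` and non-negativity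
`0 ≤ y` of the profile, the window ratio `u₁² ≤ 4 u₂²` and any constant `C' ≥ 8⁸ · 4 · max C 0` give the clause at `s`. -/
private theorem top_range_bound {x y u₁ u₂ C C' : ℝ} {s s₀ : ℕ} (hs : s ≤ 8 * s₀) (hxy : x ≤ y)
    (hy : 0 ≤ y) (hA : (s₀ : ℝ) ^ 8 * y ≤ C * u₁ ^ 2) (hu : u₁ ^ 2 ≤ 4 * u₂ ^ 2)
    (hC' : (8 : ℝ) ^ 8 * (4 * max C 0) ≤ C') : (s : ℝ) ^ 8 * x ≤ C' * u₂ ^ 2 := by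
  have hs' : (s : ℝ) ≤ 8 * (s₀ : ℝ) := by exact_mod_cast hs
  have hs8 : (s : ℝ) ^ 8 ≤ (8 : ℝ) ^ 8 * (s₀ : ℝ) ^ 8 := by
    have h := pow_le_pow_left₀ (Nat.cast_nonneg s) hs' 8
    rw [mul_pow] at h
    exact h
  have h1 : (s : ℝ) ^ 8 * x ≤ (s : ℝ) ^ 8 * y := mul_le_mul_of_nonneg_left hxy (by positivity)
  have h2 : (s : ℝ) ^ 8 * y ≤ (8 : ℝ) ^ 8 * ((s₀ : ℝ) ^ 8 * y) := by
    rw [← mul_assoc]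
    exact mul_le_mul_of_nonneg_right hs8 hy
  have h3 : C * u₁ ^ 2 ≤ max C 0 * u₁ ^ 2 := mul_le_mul_of_nonneg_right (le_max_left _ _) (sq_nonneg _)
  have h4 : max C 0 * u₁ ^ 2 ≤ max C 0 * (4 * u₂ ^ 2) := mul_le_mul_of_nonneg_left hu (le_max_right _ _)
  have h5 : (8 : ℝ) ^ 8 * (max C 0 * (4 * u₂ ^ 2)) ≤ C' * u₂ ^ 2 := by
    have h : (8 : ℝ) ^ 8 * (max C 0 * (4 * u₂ ^ 2)) = (8 : ℝ) ^ 8 * (4 * max C 0) * u₂ ^ 2 := by ring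
    rw [h]
    exact mul_le_mul_of_nonneg_right hC' (sq_nonneg _)
  have h88 : (0 : ℝ) ≤ (8 : ℝ) ^ 8 := by positivity
  calc (s : ℝ) ^ 8 * x ≤ (s : ℝ) ^ 8 * y := h1
    _ ≤ (8 : ℝ) ^ 8 * ((s₀ : ℝ) ^ 8 * y) := h2
    _ ≤ (8 : ℝ) ^ 8 * (C * u₁ ^ 2) := mul_le_mul_of_nonneg_left hA h88
    _ ≤ (8 : ℝ) ^ 8 * (max C 0 * u₁ ^ 2) := mul_le_mul_of_nonneg_left h3 h88
    _ ≤ (8 : ℝ) ^ 8 * (max C 0 * (4 * u₂ ^ 2)) := mul_le_mul_of_nonneg_left h4 h88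
    _ ≤ C' * u₂ ^ 2 := h5

/-- The same transfer for an absolute-value clause and a non-negative, antitone profile (`0 ≤ x ≤ y`). -/
private theorem top_range_bound_abs {x y u₁ u₂ C C' : ℝ} {s s₀ : ℕ} (hs : s ≤ 8 * s₀) (hx : 0 ≤ x)
    (hxy : x ≤ y) (hA : (s₀ : ℝ) ^ 8 * |y| ≤ C * u₁ ^ 2) (hu : u₁ ^ 2 ≤ 4 * u₂ ^ 2)
    (hC' : (8 : ℝ) ^ 8 * (4 * max C 0) ≤ C') : (s : ℝ) ^ 8 * |x| ≤ C' * u₂ ^ 2 := by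
  have hy : 0 ≤ y := hx.trans hxy
  rw [abs_of_nonneg hy] at hA
  rw [abs_of_nonneg hx]
  exact top_range_bound hs hxy hy hA hu hC'

/-- **Registered stub `stub_coreBridge`** (line `Sketch`, skeleton v6, `--supports stmt-QuantumFields-16204`): bookkeeping bridge: interior profiles + longitudinal monotonicity ⇒ `AFProfilesBigAt r`. For every compact `G` and lattice representation `r`. [folklore] -/
theorem stub_coreBridge :
    ∀ (G : Type) [Group G] [TopologicalSpace G] [IsTopologicalGroup G] [CompactSpace G] [MeasurableSpace G] [BorelSpace G] (r : LatticeRep G), (∀ (L : ℕ) [NeZero L] (β : ℝ), 0 ≤ β → ∀ s : ℕ, 0 ≤ wilsonExpectation r.ρ β (fun U : GaugeConfig 4 L G => ((r.N : ℝ) - (r.ρ (plaquetteHolonomy U 0 0 1)).trace.re) * ((r.N : ℝ) - (r.ρ (plaquetteHolonomy U (Pi.single (0 : Fin 4) ((s : ℕ) : ZMod L)) 0 1)).trace.re)) - wilsonExpectation r.ρ β (fun U : GaugeConfig 4 L G => (r.N : ℝ) - (r.ρ (plaquetteHolonomy U 0 0 1)).trace.re) * wilsonExpectation r.ρ β (fun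 U : GaugeConfig 4 L G => (r.N : ℝ) - (r.ρ (plaquetteHolonomy U (Pi.single (0 : Fin 4) ((s : ℕ) : ZMod L)) 0 1)).trace.re)) → (∀ (L : ℕ) [NeZero L] (β : ℝ), 0 ≤ β → ∀ k n : ℕ, 1 ≤ k → k ≤ n → 2 * n ≤ L → wilsonExpectation r.ρ β (fun U : GaugeConfig 4 L G => ((r.N : ℝ) - (r.ρ (plaquetteHolonomy U 0 0 1)).trace.re) * ((r.N : ℝ) - (r.ρ (plaquetteHolonomy U (Pi.single (0 : Fin 4) ((n : ℕ) : ZMod L)) 0 1)).trace.re)) - wilsonExpectation r.ρ β (fun U : GaugeConfig 4 L G => (r.N : ℝ) - (r.ρ (plaquetteHolonomy U 0 0 1)).trace.re) * wilsonExpectation r.ρ β (fun U : GaugeConfig 4 L G => (r.N : ℝ) - (r.ρ (plaquetteHolonomy U (Pi.single (0 : Fin 4) ((n : ℕ) : ZMod L)) 0 1)).trace.re) ≤ wilsonExpectation r.ρ β (fun U : GaugeConfig 4 L G => ((r.N : ℝ) - (r.ρ (plaquetteHolonomy U 0 0 1)).trace.re) * ((r.N : ℝ) - (r.ρ (plaquetteHolonomy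 U (Pi.single (0 : Fin 4) ((k : ℕ) : ZMod L)) 0 1)).trace.re)) - wilsonExpectation r.ρ β (fun U : GaugeConfig 4 L G => (r.N : ℝ) - (r.ρ (plaquetteHolonomy U 0 0 1)).trace.re) * wilsonExpectation r.ρ β (fun U : GaugeConfig 4 L G => (r.N : ℝ) - (r.ρ (plaquetteHolonomy U (Pi.single (0 : Fin 4) ((k : ℕ) : ZMod L)) 0 1)).trace.re)) → (∃ (u : ℕ → ℝ → ℝ) (u₀ β₀ κ₁ κ₂ κ₃ c C c₈ : ℝ), 0 < u₀ ∧ 0 < c ∧ 0 < κ₁ ∧ 0 ≤ κ₃ ∧ 0 < c₈ ∧ (∀ (L : ℕ) (β : ℝ), 8 ≤ L → β₀ ≤ β → 0 < u L β) ∧ (∀ L : ℕ, 8 ≤ L → ContinuousOn (u L) (Set.Ici β₀)) ∧ (∀ L : ℕ, 8 ≤ L → Filter.Tendsto (u L) Filter.atTop (nhds 0)) ∧ (∀ β : ℝ, β₀ ≤ β → c₈ ≤ β * u 8 β) ∧ (∀ (L L' : ℕ) (β : ℝ), β₀ ≤ β → 8 ≤ L → L ≤ L' → L' ≤ 2 *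 L → (∀ M : ℕ, 8 ≤ M → M ≤ L → u M β ≤ u₀) → |(u L β)⁻¹ - (u L' β)⁻¹| ≤ κ₂) ∧ (∀ (k m : ℕ) (β : ℝ), β₀ ≤ β → (∀ M : ℕ, 8 ≤ M → M ≤ 8 * 2 ^ (k + m) → u M β ≤ u₀) → κ₁ * m - κ₃ ≤ (u (8 * 2 ^ k) β)⁻¹ - (u (8 * 2 ^ (k + m)) β)⁻¹ ∧ (u (8 * 2 ^ k) β)⁻¹ - (u (8 * 2 ^ (k + m)) β)⁻¹ ≤ κ₂ * m + κ₃) ∧ (∀ (L : ℕ) [NeZero L] (β : ℝ) (n : ℕ), β₀ ≤ β → 1 ≤ n → 8 * n ≤ L → (∀ M : ℕ, 8 ≤ M → M ≤ L → u M β ≤ u₀) → ∀ (P : (Fin 4 → ZMod L) → Fin 4 → Fin 4 → GaugeConfig 4 L G → ℝ) (E : (GaugeConfig 4 L G → ℝ) → ℝ), (P = fun x i j U => (r.N : ℝ) - (r.ρ (plaquetteHolonomy U x i j)).trace.re) → (E = fun F => wilsonExpectation r.ρ β F) → c * u (8 * n) β ^ 2 ≤ (n : ℝ) ^ 8 * (E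 (fun U => P 0 0 1 U * P (Pi.single (2 : Fin 4) ((n : ℕ) : ZMod L)) 0 1 U) - E (P 0 0 1) * E (P (Pi.single (2 : Fin 4) ((n : ℕ) : ZMod L)) 0 1))) ∧ (∀ (L : ℕ) [NeZero L] (β : ℝ) (s : ℕ), β₀ ≤ β → 8 ≤ L → 1 ≤ s → 8 * s ≤ L → (∀ M : ℕ, 8 ≤ M → M ≤ L → u M β ≤ u₀) → ∀ (P : (Fin 4 → ZMod L) → Fin 4 → Fin 4 → GaugeConfig 4 L G → ℝ) (E : (GaugeConfig 4 L G → ℝ) → ℝ), (P = fun x i j U => (r.N : ℝ) - (r.ρ (plaquetteHolonomy U x i j)).trace.re) → (E = fun F => wilsonExpectation r.ρ β F) → (s : ℝ) ^ 8 * (E (fun U => P 0 0 1 U * P (Pi.single (2 : Fin 4) ((s : ℕ) : ZMod L)) 0 1 U) - E (P 0 0 1) * E (P (Pi.single (2 : Fin 4) ((s : ℕ) : ZMod L)) 0 1)) ≤ C * u (8 * s) β ^ 2) ∧ (∀ (L : ℕ) [NeZero L] (β : ℝ) (s : ℕ), β₀ ≤ β → 8 ≤ L → 1 ≤ s → 8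 * s ≤ L → (∀ M : ℕ, 8 ≤ M → M ≤ L → u M β ≤ u₀) → ∀ (P : (Fin 4 → ZMod L) → Fin 4 → Fin 4 → GaugeConfig 4 L G → ℝ) (E : (GaugeConfig 4 L G → ℝ) → ℝ), (P = fun x i j U => (r.N : ℝ) - (r.ρ (plaquetteHolonomy U x i j)).trace.re) → (E = fun F => wilsonExpectation r.ρ β F) → (s : ℝ) ^ 8 * |E (fun U => P 0 0 1 U * P (Pi.single (0 : Fin 4) ((s : ℕ) : ZMod L)) 0 1 U) - E (P 0 0 1) * E (P (Pi.single (0 : Fin 4) ((s : ℕ) : ZMod L)) 0 1)| ≤ C * u (8 * s) β ^ 2) ∧ (∀ (L : ℕ) [NeZero L] (β : ℝ), β₀ ≤ β → 8 ≤ L → (∀ M : ℕ, 8 ≤ M → M ≤ L → u M β ≤ u₀) → ∀ (P : (Fin 4 → ZMod L) → Fin 4 → Fin 4 → GaugeConfig 4 L G → ℝ) (E : (GaugeConfig 4 L G → ℝ) → ℝ), (P = fun x i j U => (r.N : ℝ) - (r.ρ (plaquetteHolonomy U x i j)).trace.re) → (E = fun F => wilsonExpectation r.ρ β F) → E (fun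 U => P 0 0 1 U * P 0 0 1 U) - E (P 0 0 1) * E (P 0 0 1) ≤ C * u 8 β ^ 2)) → AFProfilesBigAt r := by
  intro G _ _ _ _ _ _ r HN HA HC
  obtain ⟨u, u₀, β₀, κ₁, κ₂, κ₃, c, C, c₈, hu₀, hc, hκ₁, hκ₃, hc₈, hpos, hcont, hfrz, hbare, hcomp, hstep,
    hTL, hTU, hLU, hV⟩ := HC
  -- the shrunk window height, the raised threshold (`β ≥ 1 ≥ 0` for reflection positivity), the enlarged constant
  obtain ⟨w, hwpos, hw₀, hwκ⟩ := exists_window u₀ κ₂ hu₀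
  obtain ⟨β₁, hβ₁₀, hβ₁1⟩ : ∃ β₁ : ℝ, β₀ ≤ β₁ ∧ 1 ≤ β₁ := ⟨max β₀ 1, le_max_left _ _, le_max_right _ _⟩
  obtain ⟨C', hCC', hC'⟩ := exists_constant C
  -- windows w.r.t. `w` are windows w.r.t. `u₀`
  have hwin_mono : ∀ (L : ℕ) (β : ℝ), (∀ M : ℕ, 8 ≤ M → M ≤ L → u M β ≤ w) →
      ∀ M : ℕ, 8 ≤ M → M ≤ L → u M β ≤ u₀ := fun L β h M h8 hM => (h M h8 hM).trans hw₀
  -- the window ratio `u(8 s₀, β)² ≤ 4 u(L, β)²` inside a `w`-window box `L ≤ 32 s₀`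
  have hratio : ∀ (L s₀ : ℕ) (β : ℝ), β₀ ≤ β → 8 ≤ L → 1 ≤ s₀ → 8 * s₀ ≤ L → L ≤ 4 * (8 * s₀) →
      (∀ M : ℕ, 8 ≤ M → M ≤ L → u M β ≤ w) → u (8 * s₀) β ^ 2 ≤ 4 * u L β ^ 2 := by
    intro L s₀ β hβ0 hL8 hs₀1 h8s₀ hL4 hwin
    exact stub_windowRatio (fun M => u M β) u₀ w κ₂ L (fun M h8 => hpos M β h8 hβ0)
      (fun M M' h8 hMM' hM'M hwM => hcomp M M' β hβ0 h8 hMM' hM'M hwM) hw₀ hwκ hwin (8 * s₀) L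
      (by omega) hL8 h8s₀ le_rfl (by omega) hL4
  refine ⟨u, w, β₁, κ₁, κ₂, κ₃, c, C', c₈, hwpos, hc, hκ₁, hκ₃, hc₈,
    fun L β hL hβ => hpos L β hL (hβ₁₀.trans hβ),
    fun L hL => (hcont L hL).mono (Set.Ici_subset_Ici.2 hβ₁₀),
    fun L hL => hfrz L hL,
    fun β hβ => hbare β (hβ₁₀.trans hβ),
    fun L L' β hβ hL hLL' hL'L hwin => hcomp L L' β (hβ₁₀.trans hβ) hL hLL' hL'L (hwin_mono L β hwin),
    fun k m β hβ hwin => hstep k m β (hβ₁₀.trans hβ) (hwin_mono _ β hwin), ?_, ?_, ?_, ?_⟩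
  · -- transverse lower profile: carried over
    intro L _ β n hβ hn hnL hwin P E hP hE
    exact hTL L β n (hβ₁₀.trans hβ) hn hnL (hwin_mono L β hwin) P E hP hE
  · -- transverse upper profile on `1 ≤ s ≤ L/2`
    intro L _ β s hβ hL8 hs h2s hwin P E hP hE
    have hβ0 : β₀ ≤ β := hβ₁₀.trans hβ
    have hβnn : (0 : ℝ) ≤ β := zero_le_one.trans (hβ₁1.trans hβ)
    have hwin₀ := hwin_mono L β hwin
    rcases le_or_gt (8 * s) L with h8s | h8s
    · -- interior range `8s ≤ L`: the core clause itself
      have hsc : max 8 (min L (8 * s)) = 8 * s := by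
        rw [Nat.min_eq_right h8s, Nat.max_eq_right (by omega)]
      rw [hsc]
      exact (hTU L β s hβ0 hL8 hs h8s hwin₀ P E hP hE).trans
        (mul_le_mul_of_nonneg_right hCC' (sq_nonneg _))
    · -- top range `L < 8s`: antitonicity down to `s₀ = L/8`, the core clause at `s₀`, the window ratio
      have hsc : max 8 (min L (8 * s)) = L := by
        rw [Nat.min_eq_left h8s.le, Nat.max_eq_right hL8]
      rw [hsc]
      obtain ⟨s₀, hs₀1, h8s₀, hs₀s, hs8s₀, hL4⟩ := exists_bottom_scale hL8 h2s h8s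
      have hcore := hTU L β s₀ hβ0 hL8 hs₀1 h8s₀ hwin₀ P E hP hE
      have hr := hratio L s₀ β hβ0 hL8 hs₀1 h8s₀ hL4 hwin
      subst hP hE
      exact top_range_bound hs8s₀
        (FemtoCurvatureTwoPoint.stub_axisProfileAntitone L r.N G r.ρ r.continuous β hβnn s₀ s hs₀s h2s)
        (FemtoCurvatureTwoPoint.stub_axisCovNonneg L r.N G r.ρ r.continuous β hβnn s₀) hcore hr hC'
  · -- longitudinal upper profile on `1 ≤ s ≤ L/2`
    intro L _ β s hβ hL8 hs h2s hwin P E hP hE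
    have hβ0 : β₀ ≤ β := hβ₁₀.trans hβ
    have hβnn : (0 : ℝ) ≤ β := zero_le_one.trans (hβ₁1.trans hβ)
    have hwin₀ := hwin_mono L β hwin
    rcases le_or_gt (8 * s) L with h8s | h8s
    · -- interior range `8s ≤ L`: the core clause itself
      have hsc : max 8 (min L (8 * s)) = 8 * s := by
        rw [Nat.min_eq_right h8s, Nat.max_eq_right (by omega)]
      rw [hsc]
      exact (hLU L β s hβ0 hL8 hs h8s hwin₀ P E hP hE).trans
        (mul_le_mul_of_nonneg_right hCC' (sq_nonneg _))
    · -- top range `L < 8s`: `0 ≤ g_L(s) ≤ g_L(s₀)` (HN, HA), the core clause at `s₀`, the window ratio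
      have hsc : max 8 (min L (8 * s)) = L := by
        rw [Nat.min_eq_left h8s.le, Nat.max_eq_right hL8]
      rw [hsc]
      obtain ⟨s₀, hs₀1, h8s₀, hs₀s, hs8s₀, hL4⟩ := exists_bottom_scale hL8 h2s h8s
      have hcore := hLU L β s₀ hβ0 hL8 hs₀1 h8s₀ hwin₀ P E hP hE
      have hr := hratio L s₀ β hβ0 hL8 hs₀1 h8s₀ hL4 hwin
      subst hP hE
      exact top_range_bound_abs hs8s₀ (HN L β hβnn s) (HA L β hβnn s₀ s hs₀1 hs₀s h2s) hcore hr hC'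
  · -- variance ceiling: carried over with `C ≤ C'`
    intro L _ β hβ hL hwin P E hP hE
    exact (hV L β (hβ₁₀.trans hβ) hL (hwin_mono L β hwin) P E hP hE).trans
      (mul_le_mul_of_nonneg_right hCC' (sq_nonneg _))

end Summit.QuantumFields.YangMills.Theorems.FemtoCurvatureTwoPointC

end
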